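import Literature.Analysis.FluidPDE.Tao2016AveragedNS.SeedScaleEntry
import Literature.Analysis.FluidPDE.Tao2016AveragedNS.SeedScaleSharpIgnition
import HarnessLib

/-!
# The transition-entry state at the SHARP budget `δ₀ + 2δ ≤ 1.2532·ε²e^{-M}/√M`

S. Bloch-style note for the FLUID COMPUTER cell (pub-fluidc, blueprint seat bp1). HONEST FRAMING:
this is a low prior, high value-of-information experiment on Tao's machine paradigm
[Tao2016AveragedNS, §5.5]; NOT a claim that NS blows up. Everything here concerns Tao's
five-mode delay circuit `delayCircuitWith K M ε` (an ODE on `ℝ⁵`) and its pseudo-orbits.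

`SeedScaleEntry.lean` proves the entry state of Tao's transition phase — the first time
`τ ∈ (1, 8/5]` at which the trigger reaches `Thm53With`'s level `ε²/K¹⁰`, with `c > 0` behind it,
`b ≥ (49/50)ε` on `[1, τ]` and `a² ≥ 999/1000`, `|d|, |ã| ≤ 4/K¹⁰` on `[0, τ]` — for approximate
trajectories under the seed-scale budget `δ₀ + 2δ ≤ ε²e^{-M}/(8√M)`. This file proves the SAME entry
state under the sharp budget `δ₀ + 2δ ≤ (3133/2500)·ε²e^{-M}/√M` of `SeedScaleSharpIgnition.lean`
(any constant below the dud threshold `√(π/2) = 1.25331…`), in particular under the exponent-5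
budget `ε²e^{-M}/K⁵ ≤ ε²e^{-M}/√M` on the WHOLE family `M ≤ K¹⁰` (the corner `K¹⁰/64 < M ≤ K¹⁰`
included), which is the first link of the `q = 5` chain.

What changes w.r.t. `SeedScaleEntry.lean`: (i) the existence of a window time with `|c| > ε²` comes
from `ignitesWithin_sharp` (Gaussian window mass `√(π/2)`) instead of `exists_abs_c_gt_sq` (crude
mass `9/20`); (ii) the positivity of `c` behind the hitting time is certified on `[1, τ]` (not on
`[1/√M, τ]`: under the sharp budget a negative pre-load `δ₀ ≈ 1.25·ε²e^{-M}/√M` genuinely keeps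
`c < 0` until most of the Gaussian deposit `∫₀^{u√M} e^{-x²/2}dx` has arrived), with the residue
`D ≥ ε²e^{-M}/(16000√M)` of `disc_one_ge`; (iii) every weak-budget window lemma is REUSED from the
`section Eighth` of `SeedScaleIgnition.lean` / `SeedScaleEntry.lean` (primed names), nothing copied.

Contents: §1 the hitting time and the entry state (the residue of the discounted trigger on
`[1, τ]` is recorded in place of the bare sign of `c`); §2 the exported statement
`triggerLevel_hit_sharp` (total budget `δ₀ + δT ≤ (3133/2500)·ε²e^{-M}/√M`) and its exponent-5
corollary `triggerLevel_hit_pow_five` (`δ₀ + δT ≤ ε²e^{-M}/K⁵`).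
-/

noncomputable section

open Real Set MeasureTheory intervalIntegral

namespace Literature.Analysis.FluidPDE.Tao2016AveragedNS

open NegKick (clockInt clockInt_zero)

namespace IgnitionSharp

open Ignition

section Approx

variable {K M ε δ δ₀ T : ℝ} {Y V : ℝ → Fin 5 → ℝ}
  (hY : ∀ t, HasDerivAt Y (V t) t)
  (hV : ∀ t ∈ Ico 0 T, ‖V t - delayCircuitWith K M ε (Y t)‖ ≤ δ)
  (hR : ∀ t ∈ Ico 0 T, ‖Y t‖ ≤ 2) (hT : 2 ≤ T)
include hY hV hR hT

section Sharp

variable (hK : 2 * 20 ^ 42 * (Nat.factorial 42 : ℝ) + 16 ≤ K) (hML : 3000 * Real.log K ≤ M)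
  (hMK : M ≤ K ^ 10) (hε : 0 < ε) (hεle : ε ≤ exp (-(10 * M)) / K ^ 100)
  (h0 : ‖Y 0 - delayInit‖ ≤ δ₀)
  (hηS : δ₀ + 2 * δ ≤ 3133 / 2500 * (ε ^ 2 * exp (-M)) / Real.sqrt M)
include hK hML hMK hε hεle h0 hηS

/-! ## §1. The first hitting time of the trigger level under the sharp budget -/

/-- If `|c| ≤ ε²` on `[0, τ]` (`τ ≤ 8/5`), the discounted trigger keeps the residue
`D(t) ≥ ε²e^{-M}/(16000√M)` — hence `c(t) > 0` — for `t ∈ [1, τ]` under the sharp budget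
(`D(1) ≥ -δ₀ - (51/50)δ + 1.253274·ε²e^{-M}/√M` by `disc_one_ge`, persistence with loss
`≤ (51/50)δ(t-1)`, and `δ₀ + 2δ ≤ 1.2532·ε²e^{-M}/√M`). [cite: Tao2016AveragedNS, §5.5] -/
theorem residue_of_smallH_sharp {τ : ℝ} (hτ : τ ≤ 8 / 5)
    (hc : ∀ t ∈ Icc (0 : ℝ) τ, |Y t 2| ≤ ε ^ 2) {t : ℝ} (ht : t ∈ Icc (1 : ℝ) τ) :
    ε ^ 2 * exp (-M) / (16000 * Real.sqrt M) ≤ Y t 2 * exp (-clockInt ε M Y t) ∧ 0 < Y t 2 := by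
  obtain ⟨hM6000, hε1, hε2, hexpM, hMe, hMe2, hMse, h77, hsM⟩ := ignition_params hK hML hMK hε hεle
  have hη := hηS.trans (sharp_level_le_eighth hK hML hMK hε hεle)
  obtain ⟨hδ₀, hδ, hη8, hδ₀1, h732, hs1⟩ := budget_facts' hV hT hK hML hMK hε hεle h0 hη
  have hsq0 : 0 < Real.sqrt M := by linarith
  have hwin := disc_one_ge hY hV hR hT hK hML hMK hε hεle h0 hη
  have hp := disc_persist' hY hV hT hK hML hMK hε hεle h0 hη (τ := τ) hτ
    (fun u hu => clockInt_ge_of_smallH' hY hV hT hK hML hMK hε hεle h0 hη hτ hc hu) zero_le_one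
    ht.1 ht.2
  have h1 : 102 / 100 * δ * (t - 1) ≤ 102 / 100 * δ * (3 / 5) :=
    mul_le_mul_of_nonneg_left (by linarith [ht.2]) (by positivity)
  have h2 : ε ^ 2 * exp (-M) / (16000 * Real.sqrt M) =
      1253274 / 1000000 * (ε ^ 2 * exp (-M)) / Real.sqrt M -
        12532115 / 10000000 * (ε ^ 2 * exp (-M)) / Real.sqrt M := by
    field_simp; ring
  have h3 : 3133 / 2500 * (ε ^ 2 * exp (-M)) / Real.sqrt M ≤
      12532115 / 10000000 * (ε ^ 2 * exp (-M)) / Real.sqrt M :=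
    div_le_div_of_nonneg_right (by nlinarith [mul_pos (pow_pos hε 2) (exp_pos (-M))]) hsq0.le
  have hD : ε ^ 2 * exp (-M) / (16000 * Real.sqrt M) ≤ Y t 2 * exp (-clockInt ε M Y t) := by
    rw [h2]; linarith
  refine ⟨hD, ?_⟩
  have hp0 : 0 < ε ^ 2 * exp (-M) / (16000 * Real.sqrt M) := by positivity
  by_contra hle
  have : Y t 2 * exp (-clockInt ε M Y t) ≤ 0 :=
    mul_nonpos_of_nonpos_of_nonneg (le_of_not_gt hle) (exp_pos _).le
  linarith

/-- **First hitting time of the trigger level, sharp budget.** Under the standing hypotheses and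
the sharp budget `δ₀ + 2δ ≤ (3133/2500)·ε²e^{-M}/√M` there is `τ ∈ (1, 8/5]` at which the trigger
FIRST reaches `Thm53With`'s level: `c(τ) = ε²/K¹⁰`, `|c| < ε²/K¹⁰` on `[0, τ)`; moreover the discounted trigger keeps the residue
`c·e^{-G} ≥ ε²e^{-M}/(16000√M)` (so `c > 0`) on `[1, τ]`, `b ≥ (49/50)ε` on `[1, τ]`, and on `[0, τ]`: `|b| ≤ 2ε`, `a² ≥ 999/1000`,
`|d|, |ã| ≤ 4/K¹⁰`. [cite: Tao2016AveragedNS, §5.5 Theorem 5.3 (tcable)] -/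
theorem exists_triggerLevel_hit_sharp :
    ∃ τ ∈ Ioc (1 : ℝ) (8 / 5), Y τ 2 = ε ^ 2 / K ^ 10 ∧
      (∀ t ∈ Ico (0 : ℝ) τ, |Y t 2| < ε ^ 2 / K ^ 10) ∧
      (∀ t ∈ Icc (1 : ℝ) τ,
        ε ^ 2 * exp (-M) / (16000 * Real.sqrt M) ≤ Y t 2 * exp (-clockInt ε M Y t)) ∧
      (∀ t ∈ Icc (1 : ℝ) τ, 49 / 50 * ε ≤ Y t 1) ∧
      (∀ t ∈ Icc (0 : ℝ) τ, |Y t 1| ≤ 2 * ε ∧ 999 / 1000 ≤ Y t 0 ^ 2 ∧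
        |Y t 3| ≤ 4 / K ^ 10 ∧ |Y t 4| ≤ 4 / K ^ 10) := by
  obtain ⟨hM6000, hε1, hε2, hexpM, hMe, hMe2, hMse, h77, hsM⟩ := ignition_params hK hML hMK hε hεle
  have hη := hηS.trans (sharp_level_le_eighth hK hML hMK hε hεle)
  obtain ⟨hδ₀, hδ, hη8, hδ₀1, h732, hs1⟩ := budget_facts' hV hT hK hML hMK hε hεle h0 hη
  obtain ⟨hℓ0, hℓε, hℓ3, hsK, hK10⟩ := level_facts hK hML hMK hε hεle
  obtain ⟨ℓ, hℓ⟩ : ∃ ℓ : ℝ, ℓ = ε ^ 2 / K ^ 10 := ⟨_, rfl⟩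
  rw [← hℓ] at hℓ0 hℓε hℓ3 ⊢
  -- a window time at which `|c| > ε²`: the sharp ignition theorem on the sub-window `[0, 2)`
  have hV2 : ∀ t ∈ Ico (0 : ℝ) 2, ‖V t - delayCircuitWith K M ε (Y t)‖ ≤ δ :=
    fun t ht => hV t ⟨ht.1, lt_of_lt_of_le ht.2 hT⟩
  have hR2 : ∀ t ∈ Ico (0 : ℝ) 2, ‖Y t‖ ≤ 2 := fun t ht => hR t ⟨ht.1, lt_of_lt_of_le ht.2 hT⟩
  have hB2 : δ₀ + δ * 2 ≤ 3133 / 2500 * (ε ^ 2 * exp (-M)) / Real.sqrt M := by linarith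
  obtain ⟨t₀, ht₀, hgt⟩ := ignitesWithin_sharp hK hML hMK hε hεle δ δ₀ 2 Y V le_rfl hY hV2 hR2 h0 hB2
  -- the closed set of window times at which `|c| ≥ ℓ`, and its infimum
  obtain ⟨S, hS⟩ : ∃ S : Set ℝ, S = Icc (0 : ℝ) (8 / 5) ∩ {t | ℓ ≤ |Y t 2|} := ⟨_, rfl⟩
  have hne : S.Nonempty := ⟨t₀, by rw [hS]; exact ⟨ht₀, hℓε.trans hgt.le⟩⟩
  have hbdd : BddBelow S := ⟨0, fun t ht => by rw [hS] at ht; exact ht.1.1⟩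
  have hcl : IsClosed S := by
    rw [hS]
    exact isClosed_Icc.inter (isClosed_le continuous_const (continuous_coord hY 2).abs)
  obtain ⟨τ, hτ⟩ : ∃ τ : ℝ, τ = sInf S := ⟨_, rfl⟩
  have hmem : τ ∈ S := by rw [hτ]; exact hcl.csInf_mem hne hbdd
  have hτS : τ ∈ Icc (0 : ℝ) (8 / 5) ∧ ℓ ≤ |Y τ 2| := by rw [hS] at hmem; exact hmem
  have hτ85 : τ ≤ 8 / 5 := hτS.1.2
  have hbefore : ∀ t ∈ Icc (0 : ℝ) (8 / 5), t < τ → |Y t 2| < ℓ := by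
    intro t ht htτ
    by_contra hge
    have htS : t ∈ S := by rw [hS]; exact ⟨ht, le_of_not_gt hge⟩
    have := csInf_le hbdd htS
    rw [← hτ] at this
    linarith
  -- `τ > 1`: on `[0,1]` the trigger is below `3ε²e^{-M/2} < ℓ`
  have hτ1 : 1 < τ := by
    by_contra hle
    have h := abs_c_le_unit' hY hV hR hT hK hML hMK hε hεle h0 hη ⟨hτS.1.1, le_of_not_gt hle⟩
    linarith [hτS.2]
  -- `|c(τ)| = ℓ` by the intermediate value theorem and minimality
  have hc0 : |Y 0 2| < ℓ := by
    have h := (abs_init_coord_le h0).2.1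
    have : ε ^ 2 * exp (-M) ≤ ε ^ 2 * exp (-(M / 2)) :=
      mul_le_mul_of_nonneg_left (exp_le_exp.2 (by linarith)) (sq_nonneg ε)
    linarith
  have habsτ : |Y τ 2| = ℓ := by
    have hcont : ContinuousOn (fun t => |Y t 2|) (Icc 0 τ) :=
      ((continuous_coord hY 2).abs).continuousOn
    obtain ⟨t, ht, hteq⟩ := intermediate_value_Icc hτS.1.1 hcont ⟨hc0.le, hτS.2⟩
    have htS : t ∈ S := by rw [hS]; exact ⟨⟨ht.1, ht.2.trans hτ85⟩, hteq.ge⟩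
    have hτt : τ ≤ t := by rw [hτ]; exact csInf_le hbdd htS
    have hte : t = τ := le_antisymm ht.2 hτt
    rw [← hte]; exact hteq
  have hcℓ : ∀ t ∈ Icc (0 : ℝ) τ, |Y t 2| ≤ ℓ := fun t ht => by
    rcases eq_or_lt_of_le ht.2 with h | h
    · rw [h, habsτ]
    · exact (hbefore t ⟨ht.1, ht.2.trans hτ85⟩ h).le
  have hcε : ∀ t ∈ Icc (0 : ℝ) τ, |Y t 2| ≤ ε ^ 2 := fun t ht => (hcℓ t ht).trans hℓε
  have hres : ∀ t ∈ Icc (1 : ℝ) τ,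
      ε ^ 2 * exp (-M) / (16000 * Real.sqrt M) ≤ Y t 2 * exp (-clockInt ε M Y t) :=
    fun t ht => (residue_of_smallH_sharp hY hV hR hT hK hML hMK hε hεle h0 hηS hτ85 hcε ht).1
  have hpos : ∀ t ∈ Icc (1 : ℝ) τ, 0 < Y t 2 :=
    fun t ht => (residue_of_smallH_sharp hY hV hR hT hK hML hMK hε hεle h0 hηS hτ85 hcε ht).2
  -- sign at `τ`
  have hposτ := hpos τ ⟨hτ1.le, le_rfl⟩
  have hceq : Y τ 2 = ℓ := by rw [← habsτ, abs_of_pos hposτ]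
  refine ⟨τ, ⟨hτ1, hτ85⟩, hceq, fun t ht => hbefore t ⟨ht.1, ht.2.le.trans hτ85⟩ ht.2, hres,
    fun t ht => b_ge_late_of_smallH' hY hV hR hT hK hML hMK hε hεle h0 hη hτ85 hcε ht,
    fun t ht => ?_⟩
  have hb := abs_b_le_of_smallH' hY hV hR hT hK hML hMK hε hεle h0 hη hτ85 hcε ht
  have hde := de_le_of_abs_c_le hY hV hR hT h0 hε hℓ0.le hτ85 hcℓ ht
  -- `2δ₀ + (2δ + 2ℓ/ε²)t ≤ 4/K¹⁰`
  have hℓK : 2 * ℓ / ε ^ 2 = 2 / K ^ 10 := by rw [hℓ]; field_simp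
  rw [hℓK] at hde
  have hsmall : 2 * δ₀ + (2 * δ + 2 / K ^ 10) * t ≤ 4 / K ^ 10 := by
    have ht85 : t ≤ 8 / 5 := ht.2.trans hτ85
    have h1 : (2 * δ + 2 / K ^ 10) * t ≤ (2 * δ + 2 / K ^ 10) * (8 / 5) :=
      mul_le_mul_of_nonneg_left ht85 (by positivity)
    have h2 : ε ^ 2 * exp (-M) ≤ 1 * (1 / (3 * K ^ 10)) :=
      mul_le_mul (by nlinarith) hsK (exp_pos _).le zero_le_one
    have h3 : 1 * (1 / (3 * K ^ 10)) = 1 / K ^ 10 / 3 := by ring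
    have h4 : 0 < 1 / K ^ 10 := by
      have h20 : (0 : ℝ) ≤ 2 * 20 ^ 42 * (Nat.factorial 42 : ℝ) := by positivity
      have : 0 < K := by linarith
      positivity
    have hw4 : 4 / K ^ 10 = 4 * (1 / K ^ 10) := by ring
    have hw2 : (2 * δ + 2 / K ^ 10) * (8 / 5) = 16 / 5 * δ + 16 / 5 * (1 / K ^ 10) := by ring
    linarith
  have hd : |Y t 3| ≤ 4 / K ^ 10 := hde.1.trans hsmall
  have he : |Y t 4| ≤ 4 / K ^ 10 := hde.2.trans hsmall
  -- the carrier: `a² = energy - b² - c² - d² - ã² ≥ 1 - 2ε²e^{-M} - 4ε² - ℓ² - 32/K²⁰`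
  have ha : 999 / 1000 ≤ Y t 0 ^ 2 := by
    have hE := abs_energy_sub_one_le hY hV hR hT h0 hδ₀1 (t := t) ⟨ht.1, ht.2.trans hτ85⟩
    rw [energy_five] at hE
    have hE1 := (abs_le.1 hE).1
    have hb2 : Y t 1 ^ 2 ≤ (2 * ε) ^ 2 := by
      rw [← sq_abs]; exact pow_le_pow_left₀ (abs_nonneg _) hb 2
    have hc2 : Y t 2 ^ 2 ≤ (ε ^ 2) ^ 2 := by
      rw [← sq_abs]; exact pow_le_pow_left₀ (abs_nonneg _) (hcε t ht) 2
    have hd2 : Y t 3 ^ 2 ≤ (4 / K ^ 10) ^ 2 := by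
      rw [← sq_abs]; exact pow_le_pow_left₀ (abs_nonneg _) hd 2
    have he2 : Y t 4 ^ 2 ≤ (4 / K ^ 10) ^ 2 := by
      rw [← sq_abs]; exact pow_le_pow_left₀ (abs_nonneg _) he 2
    have hw4 : 4 / K ^ 10 = 4 * (1 / K ^ 10) := by ring
    have hK4 : 4 / K ^ 10 ≤ 4 / 1000000000000 := by rw [hw4]; linarith
    have hK40 : 0 ≤ 4 / K ^ 10 := by
      have h20 : (0 : ℝ) ≤ 2 * 20 ^ 42 * (Nat.factorial 42 : ℝ) := by positivity
      have : 0 < K := by linarith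
      positivity
    have hK2 : (4 / K ^ 10) ^ 2 ≤ 4 / K ^ 10 * (4 / 1000000000000) := by
      rw [sq]; exact mul_le_mul_of_nonneg_left hK4 hK40
    have hK3 : 4 / K ^ 10 * (4 / 1000000000000) ≤ 4 / 1000000000000 * (4 / 1000000000000) :=
      mul_le_mul_of_nonneg_right hK4 (by norm_num)
    have hε4 : (ε ^ 2) ^ 2 ≤ ε ^ 2 * (1 / 100000) := by
      rw [sq]; exact mul_le_mul_of_nonneg_left hε2 (sq_nonneg ε)
    have hε5 : ε ^ 2 * (1 / 100000) ≤ 1 / 100000 * (1 / 100000) :=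
      mul_le_mul_of_nonneg_right hε2 (by norm_num)
    have hb3 : (2 * ε) ^ 2 = 4 * ε ^ 2 := by ring
    linarith
  exact ⟨hb, ha, hd, he⟩

end Sharp

end Approx

end IgnitionSharp

/-! ## §2. Exported statements -/

/-- **The trigger-level hitting time of an approximate trajectory, SHARP budget.** For every member
`delayCircuitWith K M ε` under the standing hypotheses of the family and every differentiable
approximate trajectory `Y` (velocity `V`, sup-defect `≤ δ` and sup-norm `≤ 2` on `[0,T)`, `T ≥ 2`)
issued `δ₀`-close to Tao's datum (5.6) with `δ₀ + δT ≤ (3133/2500)·ε²e^{-M}/√M` (any level below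
the dud threshold `√(π/2)·ε²e^{-M}/√M` of `NegativeKickThreshold.lean`): there is `τ ∈ (1, 8/5]` with
`c(τ) = ε²/K¹⁰`, `|c| < ε²/K¹⁰` on `[0,τ)`, `c·e^{-G} ≥ ε²e^{-M}/(16000√M)` and `b ≥ (49/50)ε` on
`[1, τ]`, and `|b| ≤ 2ε`,
`a² ≥ 999/1000`, `|d|, |ã| ≤ 4/K¹⁰` on `[0, τ]`. [cite: Tao2016AveragedNS, §5.5 Theorem 5.3] -/
theorem triggerLevel_hit_sharp (K M ε δ δ₀ T : ℝ) (Y V : ℝ → Fin 5 → ℝ)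
    (hK : 2 * 20 ^ 42 * (Nat.factorial 42 : ℝ) + 16 ≤ K) (hML : 3000 * Real.log K ≤ M)
    (hMK : M ≤ K ^ 10) (hε : 0 < ε) (hεle : ε ≤ exp (-(10 * M)) / K ^ 100) (hT : 2 ≤ T)
    (hY : ∀ t, HasDerivAt Y (V t) t)
    (hV : ∀ t ∈ Ico 0 T, ‖V t - delayCircuitWith K M ε (Y t)‖ ≤ δ)
    (hR : ∀ t ∈ Ico 0 T, ‖Y t‖ ≤ 2) (h0 : ‖Y 0 - delayInit‖ ≤ δ₀)
    (hB : δ₀ + δ * T ≤ 3133 / 2500 * (ε ^ 2 * exp (-M)) / Real.sqrt M) :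
    ∃ τ ∈ Ioc (1 : ℝ) (8 / 5), Y τ 2 = ε ^ 2 / K ^ 10 ∧
      (∀ t ∈ Ico (0 : ℝ) τ, |Y t 2| < ε ^ 2 / K ^ 10) ∧
      (∀ t ∈ Icc (1 : ℝ) τ,
        ε ^ 2 * exp (-M) / (16000 * Real.sqrt M) ≤ Y t 2 * exp (-clockInt ε M Y t)) ∧
      (∀ t ∈ Icc (1 : ℝ) τ, 49 / 50 * ε ≤ Y t 1) ∧
      (∀ t ∈ Icc (0 : ℝ) τ, |Y t 1| ≤ 2 * ε ∧ 999 / 1000 ≤ Y t 0 ^ 2 ∧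
        |Y t 3| ≤ 4 / K ^ 10 ∧ |Y t 4| ≤ 4 / K ^ 10) := by
  have hδ : 0 ≤ δ := Ignition.defect_nonneg hV hT
  have hηS : δ₀ + 2 * δ ≤ 3133 / 2500 * (ε ^ 2 * exp (-M)) / Real.sqrt M := by nlinarith
  exact IgnitionSharp.exists_triggerLevel_hit_sharp hY hV hR hT hK hML hMK hε hεle h0 hηS

/-- The exponent-5 level is below the sharp level: `ε²e^{-M}/K⁵ ≤ (3133/2500)·ε²e^{-M}/√M`
(`√M ≤ K⁵` on the family `M ≤ K¹⁰`). [cite: Tao2016AveragedNS, §5.5] -/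
theorem IgnitionSharp.pow_five_level_le_sharp {K M ε : ℝ}
    (hK : 2 * 20 ^ 42 * (Nat.factorial 42 : ℝ) + 16 ≤ K) (hML : 3000 * Real.log K ≤ M)
    (hMK : M ≤ K ^ 10) (hε : 0 < ε) (hεle : ε ≤ exp (-(10 * M)) / K ^ 100) :
    ε ^ 2 * exp (-M) / K ^ 5 ≤ 3133 / 2500 * (ε ^ 2 * exp (-M)) / Real.sqrt M := by
  obtain ⟨hK16, hM4, -⟩ := negKick_params hK hML hMK hε hεle
  have hM0 : 0 < M := by linarith
  have hsq0 : 0 < Real.sqrt M := Real.sqrt_pos.2 hM0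
  have hs : 0 ≤ ε ^ 2 * exp (-M) := by positivity
  have hsqK : Real.sqrt M ≤ K ^ 5 := by
    rw [Real.sqrt_le_left (by positivity)]
    calc M ≤ K ^ 10 := hMK
      _ = (K ^ 5) ^ 2 := by ring
  calc ε ^ 2 * exp (-M) / K ^ 5 ≤ ε ^ 2 * exp (-M) / Real.sqrt M :=
        div_le_div_of_nonneg_left hs hsq0 hsqK
    _ = 1 * (ε ^ 2 * exp (-M)) / Real.sqrt M := by ring
    _ ≤ 3133 / 2500 * (ε ^ 2 * exp (-M)) / Real.sqrt M := by gcongr; norm_num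

/-- **The same under the exponent-5 budget `δ₀ + δT ≤ ε²e^{-M}/K⁵`**, on the whole family
`M ≤ K¹⁰` (so `K⁵ ≥ √M`), the corner `K¹⁰/64 < M ≤ K¹⁰` of `SeedScaleCorner.lean` included.
[cite: Tao2016AveragedNS, §5.5 Theorem 5.3] -/
theorem triggerLevel_hit_pow_five (K M ε δ δ₀ T : ℝ) (Y V : ℝ → Fin 5 → ℝ)
    (hK : 2 * 20 ^ 42 * (Nat.factorial 42 : ℝ) + 16 ≤ K) (hML : 3000 * Real.log K ≤ M)
    (hMK : M ≤ K ^ 10) (hε : 0 < ε) (hεle : ε ≤ exp (-(10 * M)) / K ^ 100) (hT : 2 ≤ T)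
    (hY : ∀ t, HasDerivAt Y (V t) t)
    (hV : ∀ t ∈ Ico 0 T, ‖V t - delayCircuitWith K M ε (Y t)‖ ≤ δ)
    (hR : ∀ t ∈ Ico 0 T, ‖Y t‖ ≤ 2) (h0 : ‖Y 0 - delayInit‖ ≤ δ₀)
    (hB : δ₀ + δ * T ≤ ε ^ 2 * exp (-M) / K ^ 5) :
    ∃ τ ∈ Ioc (1 : ℝ) (8 / 5), Y τ 2 = ε ^ 2 / K ^ 10 ∧
      (∀ t ∈ Ico (0 : ℝ) τ, |Y t 2| < ε ^ 2 / K ^ 10) ∧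
      (∀ t ∈ Icc (1 : ℝ) τ,
        ε ^ 2 * exp (-M) / (16000 * Real.sqrt M) ≤ Y t 2 * exp (-clockInt ε M Y t)) ∧
      (∀ t ∈ Icc (1 : ℝ) τ, 49 / 50 * ε ≤ Y t 1) ∧
      (∀ t ∈ Icc (0 : ℝ) τ, |Y t 1| ≤ 2 * ε ∧ 999 / 1000 ≤ Y t 0 ^ 2 ∧
        |Y t 3| ≤ 4 / K ^ 10 ∧ |Y t 4| ≤ 4 / K ^ 10) :=
  triggerLevel_hit_sharp K M ε δ δ₀ T Y V hK hML hMK hε hεle hT hY hV hR h0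
    (hB.trans (IgnitionSharp.pow_five_level_le_sharp hK hML hMK hε hεle))

end Literature.Analysis.FluidPDE.Tao2016AveragedNS
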